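import Literature.LinearAlgebra.Alternating.DerivationExtension
import Literature.Geometry.Hyperkaehler.GenericInducedComplexStructure
import Literature.Geometry.Hyperkaehler.Hyperholomorphic
import Mathlib.LinearAlgebra.CrossProduct
import HarnessLib

/-!
# The isotropy algebra `𝔤_M = 𝔰𝔲(2)` of a hyperkähler structure acting on covectors of all degrees:
# Verbitsky's Proposition 1.2 and the genericity of induced complex structures (Verbitsky 1995 §1–§2,
# 1996 §1), pointwise

Topic `Literature/Geometry/Hyperkaehler`, namespace `Literature.Geometry.Hyperkaehler.IsLinearHyperkaehler`
(the carrier `IsLinearHyperkaehler g₀ J` of `ComplexTorusHyperkaehler.lean`: a complex normed space `E` with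
`I = i•`, a second complex structure `J` anticommuting with `I`, `K = IJ = opK J`, twistor operators
`λ_x = x₀I + x₁J + x₂K`, `x : Fin 3 → ℝ`). Lane `lit-hodgefound` (Track 2 foundations library), prover seat p06
(generation 14), self-proposed row g14-#1, FILE 2 of 2: FILE 1
(`LinearAlgebra/Alternating/DerivationExtension.lean`) constructs Verbitsky's `ad T` on `W`-valued
`k`-covectors `E [⋀^Fin k]→L[ℝ] W` (`adAlt T`), with the Leibniz rule, the Lie identity
`ad S ∘ ad T − ad T ∘ ad S = ad (T∘S − S∘T)` and `ad I = (p−q)√−1` on type `(p,q)`; this file is the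
`𝔰𝔲(2)` part. It extends to ALL DEGREES the degree-`2` statements of `InvariantTwoFormsTwistorPrimitive.lean`
(row Q1417) and `GenericInducedComplexStructure.lean` (g13-#3), where "of type `(1,1)` with respect to `R`" was
`R`-invariance `β(R·, R·) = β`; §5 proves that dictionary (`ad R β = 0 ⟺ β(R·,R·) = β` in degree `2`), and
`Hyperholomorphic.lean`'s "What is NOT here: the `SU(2)`-action on higher-degree forms".

## Sources, verbatim

* M. Verbitsky, *Hyperholomorphic bundles over a hyperkähler manifold*, J. Alg. Geom. 5 (1996) =
  alg-geom/9307008, §1 [held `paper:arxiv-alg-geom_9307008` p0001 L108–L136, p0002 L25–L50]: "Since Leibnitz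
  formula is true for a commutator in a Lie algebras, one can immediately obtain the following identities, which
  follow from the same identities in `ℍ`: `[ad I, ad J] = 2ad K; [ad J, ad K] = 2ad I; [ad K, ad I] = 2ad J`.
  Therefore, the operators `ad I, ad J, ad K` generate a Lie algebra `𝔰𝔲(2)` acting on the bundle of
  differential forms." — "Consider the Lie algebra `𝔤_M` generated by `ad L` for all `L` induced by a
  hyperkähler structure on `M`. One can easily see that `𝔤_M = 𝔰𝔲(2)`. The Lie algebra `𝔤_M` is called
  isotropy algebra of `M`" — **Proposition 1.2**: "Let `ω` be a differential form over a hyperkähler manifold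
  `M`. The form `ω` is `G_M`-invariant if and only if it is of Hodge type `(p,p)` with respect to all induced
  complex structures on `M`. Proof: Assume that `ω` is `G_M`-invariant. This implies that all elements of `𝔤_M`
  act trivially on `ω` and, in particular, that `ad L(ω) = 0` for any induced complex structure `L`. On the
  other hand, `ad L(ω) = (p−q)√−1 ω` if `ω` is of Hodge type `(p,q)`. Therefore `ω` is of Hodge type `(p,p)`
  with respect to any induced complex structure `L`. Conversely, assume that `ω` is of type `(p,p)` with
  respect to all induced `L`. Then `ad L(ω) = 0` for any induced `L`. By definition, `𝔤_M` is generated by such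
  `ad L`, and therefore `𝔤_M` and `G_M` act trivially on `ω`."
* M. Verbitsky, *Tri-analytic subvarieties of hyperkaehler manifolds*, GAFA 5 (1995) 92–104 = alg-geom/9403006,
  §2, Proposition "Let `S₀ ⊂ S` be the set of `R ∈ S` such that the natural Kähler metric on `(M, R)` induces
  the `SU(2)` action of general type. Then `S₀` is dense in `S`" with proof [held `paper:arxiv-alg-geom_9403006`
  p0003 L84–L112]: "Let `A` be the set of all `α ∈ H^{2p}(M, ℤ)` such that `α` is not `G_M`-invariant. The set
  `A` is countable. For each `α ∈ A`, let `S_α` be the set of all `R ∈ S` such that `α` is of type `(p,p)` with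
  respect to `R`. … it is sufficient to show that `S_α` is a finite set for each `α ∈ A`. This would imply that
  `S₀` is a complement of a countable set to a 2-sphere `S`, and therefore dense in `S`. As it follows from
  Section 1, `α` is of type `(p,p)` with respect to `R` if and only if `ad R(α) = 0`. Now, let `V` be a
  representation of `𝔰𝔲(2)`, and `v ∈ V` be a non-invariant vector. It is easy to see that the element
  `a ∈ 𝔰𝔲(2)` such that `a(v) = 0` is unique up to a constant, if it exists. This implies that if `α` is not
  `G_M`-invariant there are no more than two `R ∈ S` such that `ad R(α) = 0`. Of course, these two elements of
  `S` are opposite to each other."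

## What is formalised (theorems only; no definition, no named fact, no `sorry`)

"`G_M`-invariant" for a `k`-covector `β` is rendered at the Lie-algebra level as `ad I β = 0 ∧ ad J β = 0`
(`⟹ ad K β = 0`, `adAlt_opK_eq_zero`; `⟹ ad λ_z β = 0` for all `z`, `adAlt_twistorOp_eq_zero`); "of Hodge type
`(p,p)` with respect to `R`" as `ad R β = 0` ("As it follows from Section 1 …"; FILE 1
`adAlt_eq_zero_iff_isOfTypeAt` proves this equivalence for the given complex structure `I`, and §5 below proves
it is `R`-invariance in degree `2`).

* §1 `adAlt_twistorOp` (`ad λ_z = z₀ ad I + z₁ ad J + z₂ ad K`), `twistorOp_comp_sub_comp`, and the `𝔰𝔲(2)`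
  relations in every degree: **`adAlt_twistorOp_commutator`** (`ad λ_x ∘ ad λ_y − ad λ_y ∘ ad λ_x = −2 ad λ_{x×y}`),
  `adAlt_opI_adAlt_J_sub`, `adAlt_J_adAlt_opK_sub`, `adAlt_opK_adAlt_opI_sub` (`[ad I, ad J] = −2 ad K`,
  `[ad J, ad K] = −2 ad I`, `[ad K, ad I] = −2 ad J`).
* §2 **`adAlt_twistorOp_eq_zero_of_two`** / `adAlt_I_J_K_eq_zero_of_two`: two NON-PARALLEL parameters
  `x, y` (`x × y ≠ 0`) with `ad λ_x β = ad λ_y β = 0` force `ad λ_z β = 0` for every `z` ("the element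
  `a ∈ 𝔰𝔲(2)` such that `a(v) = 0` is unique up to a constant") — no unit hypothesis is needed at the
  Lie-algebra level; **`forall_unit_adAlt_twistorOp_eq_zero_iff`** (Prop. 1.2: `ad L β = 0` for all induced
  `L` iff `ad I β = 0 ∧ ad J β = 0`); with FILE 1, `isOfTypeAt_of_adAlt_opI_eq_zero` (even degree `2p`: then
  `β` is of type `(p,p)` for `I`) and `eq_zero_of_adAlt_opI_eq_zero_of_odd` (no odd invariants).
* §3 **`eq_or_eq_neg_of_adAlt_twistorOp_eq_zero`** ("no more than two `R ∈ S` … opposite to each other"),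
  `finite_setOf_adAlt_twistorOp_eq_zero` ("`S_α` is a finite set").
* §4 **`countable_setOf_exists_adAlt_twistorOp_eq_zero`** (for a COUNTABLE family `A` of `k`-covectors — e.g.
  the rational constant `2p`-forms of a hyperkähler complex torus, the case the lane uses — the unit parameters
  annihilating some non-invariant member of `A` form a countable set), `exists_unit_near_not_mem_of_countable`
  ("a complement of a countable set to a 2-sphere … dense": great circles), and
  **`exists_near_forall_adAlt_twistorOp_eq_zero_imp`** (density of the generic parameters).
* §5 the degree-`2` dictionary: **`adAlt_eq_zero_iff_apply₂_invariant`** (`T² = −1`: `ad T β = 0` iff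
  `β(T·, T·) = β`) and `adAlt_opI_J_eq_zero_iff_apply₂_invariant` (the hypotheses of
  `GenericInducedComplexStructure.lean` are `ad I β = 0 ∧ ad J β = 0`).
* §6 at a point `x` of a hyperkähler manifold `(M, g, I, J, K)` of the tree (`IsHyperkaehlerTriple g J K`, via
  `IsHyperkaehlerTriple.isLinearHyperkaehler`): `K_eq_opK`, `inducedJ_eq_twistorOp`,
  **`forall_adAlt_inducedJ_eq_zero_iff`** (Prop. 1.2 for the tree's induced complex structures `inducedJ`, all
  degrees) and **`isSU2InvariantAt_iff_adAlt`** (the tree's `IsSU2InvariantAt` of `Hyperholomorphic.lean` is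
  `ad I β = 0 ∧ ad J β = 0`).

SCOPE NOTES (faithfulness). (i) Pointwise only; the integration of `𝔰𝔲(2)` to the group `SU(2)` (Prop. 1.1)
is not formalised beyond FILE 1's `rotate_eq_self_of_adAlt_eq_zero` (an `ad I`-trivial covector is fixed by
the circle of `I`), so "`G_M`-invariant" is the infinitesimal condition; for `2`-covectors §5/§6 identify it
with the group-level `IsSU2InvariantAt` (`isSU2InvariantAt_iff_quaternion`). (ii) Signs: with FILE 1's
transposition convention `[ad I, ad J] = −2 ad K` for `K = IJ` where the source prints `+2 ad K` (see FILE 1's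
note); all statements here are insensitive to it. (iii) Verbitsky's `A ⊂ H^{2p}(M, ℤ)` is any countable set of
covectors here; cohomology is not touched.

## References

* [Verbitsky1996Hyperholomorphic] M. Verbitsky, *Hyperholomorphic bundles over a hyperkähler manifold*,
  J. Alg. Geom. 5 (1996) 633–669 = alg-geom/9307008, §1 (the `𝔰𝔲(2)` relations, `𝔤_M`, Prop. 1.2), Def. 2.1.
* [Verbitsky1995Trianalytic] M. Verbitsky, *Tri-analytic subvarieties of hyperkaehler manifolds*, GAFA 5
  (1995) 92–104 = alg-geom/9403006, §1, §2 (Proposition "`S₀` is dense in `S`" and its proof).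
* [Huybrechts2016K3] D. Huybrechts, *Lectures on K3 Surfaces* (2016), Ch. 7 §3.2 (`λ = aI + bJ + cK`; the
  tree's `inducedJ`, `IsHyperkaehlerTriple`).
-/

noncomputable section

open scoped Manifold Matrix
open Complex Function Finset Literature.LinearAlgebra.Alternating Literature.Analysis.Complex

namespace Literature.Geometry.Hyperkaehler

variable {E : Type*} [NormedAddCommGroup E] [NormedSpace ℂ E]
  {g₀ : E →L[ℝ] E →L[ℝ] ℝ} {J : E →L[ℝ] E}
  {W : Type*} [NormedAddCommGroup W] [NormedSpace ℝ W] {k : ℕ}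

namespace IsLinearHyperkaehler

/-! ## §1 The `𝔰𝔲(2)` relations for `ad` of the twistor operators -/

/-- The twistor operator is linear in its parameter (operator level): `λ_{c•z} = c • λ_z`. [folklore] -/
private theorem twistorOp_param_smul (c : ℝ) (z : Fin 3 → ℝ) :
    ((c • z) 0 • opI E + (c • z) 1 • J + (c • z) 2 • opK J) = c • (z 0 • opI E + z 1 • J + z 2 • opK J) := by
  ext v
  simp only [Pi.smul_apply, smul_eq_mul, add_apply, smul_apply, smul_add, smul_smul]

/-- The twistor operator is linear in its parameter (operator level): three-term combinations. [folklore] -/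
private theorem twistorOp_param_lincomb (a b c : ℝ) (x y n : Fin 3 → ℝ) :
    ((a • x + b • y + c • n) 0 • opI E + (a • x + b • y + c • n) 1 • J + (a • x + b • y + c • n) 2 • opK J) =
      a • (x 0 • opI E + x 1 • J + x 2 • opK J) + b • (y 0 • opI E + y 1 • J + y 2 • opK J) +
        c • (n 0 • opI E + n 1 • J + n 2 • opK J) := by
  ext v
  simp only [Pi.add_apply, Pi.smul_apply, smul_eq_mul, add_apply, smul_apply, smul_add, smul_smul, add_smul]
  abel

/-- `ad λ_z = z₀ ad I + z₁ ad J + z₂ ad K` (linearity of `ad` in the endomorphism).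
[cite: Verbitsky1996Hyperholomorphic, §1 (definition of ad I)] -/
theorem adAlt_twistorOp (z : Fin 3 → ℝ) (β : E [⋀^Fin k]→L[ℝ] W) :
    adAlt (z 0 • opI E + z 1 • J + z 2 • opK J) β =
      z 0 • adAlt (opI E) β + z 1 • adAlt J β + z 2 • adAlt (opK J) β := by
  rw [adAlt_add, adAlt_add, adAlt_smul, adAlt_smul, adAlt_smul]

/-- **`[λ_x, λ_y] = 2 λ_{x×y}` at the operator level** (`λ_y ∘ λ_x − λ_x ∘ λ_y = −2 λ_{x×y}`; the quaternion
relations). [cite: Verbitsky1995Trianalytic, §2 ("𝔤_M ≅ 𝔰𝔲(2)")] -/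
theorem twistorOp_comp_sub_comp (h : IsLinearHyperkaehler g₀ J) (x y : Fin 3 → ℝ) :
    (y 0 • opI E + y 1 • J + y 2 • opK J).comp (x 0 • opI E + x 1 • J + x 2 • opK J) -
        (x 0 • opI E + x 1 • J + x 2 • opK J).comp (y 0 • opI E + y 1 • J + y 2 • opK J) =
      -((2 : ℝ) • ((x ⨯₃ y) 0 • opI E + (x ⨯₃ y) 1 • J + (x ⨯₃ y) 2 • opK J)) := by
  ext v
  have e := h.twistorOp_commutator x y v
  simp only [sub_apply, ContinuousLinearMap.comp_apply, neg_apply, smul_apply, add_apply, opI_apply, opK_apply,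
    cross_apply, Matrix.cons_val_zero, Matrix.cons_val_one, Matrix.cons_val_two, Matrix.head_cons,
    Matrix.tail_cons] at e ⊢
  rw [← neg_sub, e]

/-- **`[ad λ_x, ad λ_y] = −2 ad λ_{x×y}`** for the twistor operators `λ_x = x₀I + x₁J + x₂K` acting on
`k`-covectors of any degree ("`[ad I, ad J] = 2ad K; [ad J, ad K] = 2ad I; [ad K, ad I] = 2ad J`. Therefore, the
operators `ad I, ad J, ad K` generate a Lie algebra `𝔰𝔲(2)`"; the sign is that of the transposition convention,
see FILE 1). [cite: Verbitsky1996Hyperholomorphic, §1 (the 𝔰𝔲(2) relations)] -/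
theorem adAlt_twistorOp_commutator (h : IsLinearHyperkaehler g₀ J) (x y : Fin 3 → ℝ) (β : E [⋀^Fin k]→L[ℝ] W) :
    adAlt (x 0 • opI E + x 1 • J + x 2 • opK J) (adAlt (y 0 • opI E + y 1 • J + y 2 • opK J) β) -
        adAlt (y 0 • opI E + y 1 • J + y 2 • opK J) (adAlt (x 0 • opI E + x 1 • J + x 2 • opK J) β) =
      -((2 : ℝ) • adAlt ((x ⨯₃ y) 0 • opI E + (x ⨯₃ y) 1 • J + (x ⨯₃ y) 2 • opK J) β) := by
  rw [adAlt_adAlt_sub_adAlt_adAlt, h.twistorOp_comp_sub_comp, adAlt_neg, adAlt_smul]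

/-- `[ad I, ad J] = −2 ad K` (`K = IJ`). [cite: Verbitsky1996Hyperholomorphic, §1 (the 𝔰𝔲(2) relations)] -/
theorem adAlt_opI_adAlt_J_sub (h : IsLinearHyperkaehler g₀ J) (β : E [⋀^Fin k]→L[ℝ] W) :
    adAlt (opI E) (adAlt J β) - adAlt J (adAlt (opI E) β) = -((2 : ℝ) • adAlt (opK J) β) := by
  have hop : J.comp (opI E) - (opI E).comp J = -((2 : ℝ) • opK J) := by
    ext v
    simp only [sub_apply, ContinuousLinearMap.comp_apply, opI_apply, h.J_I, neg_apply, smul_apply, opK_apply]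
    module
  rw [adAlt_adAlt_sub_adAlt_adAlt, hop, adAlt_neg, adAlt_smul]

/-- `[ad J, ad K] = −2 ad I`. [cite: Verbitsky1996Hyperholomorphic, §1 (the 𝔰𝔲(2) relations)] -/
theorem adAlt_J_adAlt_opK_sub (h : IsLinearHyperkaehler g₀ J) (β : E [⋀^Fin k]→L[ℝ] W) :
    adAlt J (adAlt (opK J) β) - adAlt (opK J) (adAlt J β) = -((2 : ℝ) • adAlt (opI E) β) := by
  have hop : (opK J).comp J - J.comp (opK J) = -((2 : ℝ) • opI E) := by
    ext v
    simp only [sub_apply, ContinuousLinearMap.comp_apply, opI_apply, opK_apply, h.J_J, h.J_I, neg_apply,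
      smul_apply, smul_neg]
    module
  rw [adAlt_adAlt_sub_adAlt_adAlt, hop, adAlt_neg, adAlt_smul]

/-- `[ad K, ad I] = −2 ad J`. [cite: Verbitsky1996Hyperholomorphic, §1 (the 𝔰𝔲(2) relations)] -/
theorem adAlt_opK_adAlt_opI_sub (h : IsLinearHyperkaehler g₀ J) (β : E [⋀^Fin k]→L[ℝ] W) :
    adAlt (opK J) (adAlt (opI E) β) - adAlt (opI E) (adAlt (opK J) β) = -((2 : ℝ) • adAlt J β) := by
  have hop : (opI E).comp (opK J) - (opK J).comp (opI E) = -((2 : ℝ) • J) := by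
    ext v
    simp only [sub_apply, ContinuousLinearMap.comp_apply, opI_apply, opK_apply, h.J_I, neg_apply, smul_apply,
      smul_smul, I_mul_I, smul_neg, neg_one_smul, neg_neg]
    module
  rw [adAlt_adAlt_sub_adAlt_adAlt, hop, adAlt_neg, adAlt_smul]

/-! ## §2 The annihilator of a covector in `𝔰𝔲(2)`: two induced complex structures suffice -/

/-- `ad I β = 0` and `ad J β = 0` force `ad K β = 0` (`ad K = −½ [ad I, ad J]`).
[cite: Verbitsky1996Hyperholomorphic, §1 Prop. 1.2 (proof: "𝔤_M is generated by such ad L")] -/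
theorem adAlt_opK_eq_zero (h : IsLinearHyperkaehler g₀ J) {β : E [⋀^Fin k]→L[ℝ] W} (hI : adAlt (opI E) β = 0)
    (hJ : adAlt J β = 0) : adAlt (opK J) β = 0 := by
  have e := h.adAlt_opI_adAlt_J_sub β
  rw [hI, hJ, map_zero, map_zero, sub_zero] at e
  have e' : (2 : ℝ) • adAlt (opK J) β = 0 := by rw [← neg_eq_zero, ← e]
  exact (smul_eq_zero.1 e').resolve_left two_ne_zero

/-- **`𝔰𝔲(2)`-triviality from `I` and `J`**: `ad I β = 0`, `ad J β = 0` ⟹ `ad λ_z β = 0` for every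
`λ_z = z₀I + z₁J + z₂K` (Prop. 1.2, ⇐: "`𝔤_M` and `G_M` act trivially on `ω`"), all degrees, any values.
[cite: Verbitsky1996Hyperholomorphic, §1 Prop. 1.2 (proof)] -/
theorem adAlt_twistorOp_eq_zero (h : IsLinearHyperkaehler g₀ J) {β : E [⋀^Fin k]→L[ℝ] W}
    (hI : adAlt (opI E) β = 0) (hJ : adAlt J β = 0) (z : Fin 3 → ℝ) :
    adAlt (z 0 • opI E + z 1 • J + z 2 • opK J) β = 0 := by
  rw [adAlt_twistorOp, hI, hJ, h.adAlt_opK_eq_zero hI hJ, smul_zero, smul_zero, smul_zero, add_zero, add_zero]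

/-- Coordinates with respect to the basis `x, y, x × y` of `ℝ³` (valid when `x × y ≠ 0`):
`|n|² z = ⟨z, y × n⟩ x + ⟨z, n × x⟩ y + ⟨z, n⟩ n` for `n = x × y`. [folklore] -/
private theorem cross_coordinates' (x y z : Fin 3 → ℝ) :
    ((x ⨯₃ y) ⬝ᵥ (x ⨯₃ y)) • z =
      (z ⬝ᵥ (y ⨯₃ (x ⨯₃ y))) • x + (z ⬝ᵥ ((x ⨯₃ y) ⨯₃ x)) • y + (z ⬝ᵥ (x ⨯₃ y)) • (x ⨯₃ y) := by
  obtain ⟨a₀, a₁, a₂, rfl⟩ : ∃ a₀ a₁ a₂ : ℝ, x = ![a₀, a₁, a₂] :=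
    ⟨x 0, x 1, x 2, by ext i; fin_cases i <;> rfl⟩
  obtain ⟨b₀, b₁, b₂, rfl⟩ : ∃ b₀ b₁ b₂ : ℝ, y = ![b₀, b₁, b₂] :=
    ⟨y 0, y 1, y 2, by ext i; fin_cases i <;> rfl⟩
  obtain ⟨c₀, c₁, c₂, rfl⟩ : ∃ c₀ c₁ c₂ : ℝ, z = ![c₀, c₁, c₂] :=
    ⟨z 0, z 1, z 2, by ext i; fin_cases i <;> rfl⟩
  simp only [cross_apply, Matrix.cons_val_zero, Matrix.cons_val_one, Matrix.cons_val_two, Matrix.head_cons,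
    Matrix.tail_cons, Matrix.vec3_dotProduct', Matrix.smul_vec3, Matrix.vec3_add, smul_eq_mul]
  refine Matrix.vec3_eq ?_ ?_ ?_ <;> ring

/-- **Two NON-PARALLEL elements of `𝔰𝔲(2)` annihilating `β` force the whole `𝔰𝔲(2)` to annihilate `β`**
(Verbitsky: "the element `a ∈ 𝔰𝔲(2)` such that `a(v) = 0` is unique up to a constant, if it exists", for a
non-invariant `v`), all degrees, any values: if `ad λ_x β = 0 = ad λ_y β` with `x × y ≠ 0` then `ad λ_z β = 0`
for every `z` (the annihilator is a Lie subalgebra containing `λ_x, λ_y`, hence `λ_{x×y}` by §1, and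
`x, y, x × y` span `ℝ³`). No unit hypotheses are needed at the Lie-algebra level.
[cite: Verbitsky1995Trianalytic, §2 (Proposition "S₀ is dense in S", proof)] -/
theorem adAlt_twistorOp_eq_zero_of_two (h : IsLinearHyperkaehler g₀ J) {β : E [⋀^Fin k]→L[ℝ] W}
    {x y : Fin 3 → ℝ} (hxy : x ⨯₃ y ≠ 0)
    (hβx : adAlt (x 0 • opI E + x 1 • J + x 2 • opK J) β = 0)
    (hβy : adAlt (y 0 • opI E + y 1 • J + y 2 • opK J) β = 0) (z : Fin 3 → ℝ) :
    adAlt (z 0 • opI E + z 1 • J + z 2 • opK J) β = 0 := by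
  set n := x ⨯₃ y with hn
  -- `ad λ_n β = 0` from the commutator
  have hβn : adAlt (n 0 • opI E + n 1 • J + n 2 • opK J) β = 0 := by
    have e := h.adAlt_twistorOp_commutator x y β
    rw [hβy, hβx, map_zero, map_zero, sub_zero] at e
    have e' : (2 : ℝ) • adAlt (n 0 • opI E + n 1 • J + n 2 • opK J) β = 0 := by rw [← neg_eq_zero, ← e]
    exact (smul_eq_zero.1 e').resolve_left two_ne_zero
  -- coordinates along `x, y, n`
  have hnn : n ⬝ᵥ n ≠ 0 := fun h0 ↦ hxy (dotProduct_self_eq_zero.1 h0)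
  have key : adAlt (((n ⬝ᵥ n) • z) 0 • opI E + ((n ⬝ᵥ n) • z) 1 • J + ((n ⬝ᵥ n) • z) 2 • opK J) β = 0 := by
    rw [hn, cross_coordinates' x y z, ← hn, twistorOp_param_lincomb, adAlt_add, adAlt_add, adAlt_smul, adAlt_smul,
      adAlt_smul, hβx, hβy, hβn, smul_zero, smul_zero, smul_zero, add_zero, add_zero]
  rw [twistorOp_param_smul, adAlt_smul] at key
  exact (smul_eq_zero.1 key).resolve_left hnn

/-- In particular two non-parallel annihilating twistor operators give `ad I β = 0`, `ad J β = 0`, `ad K β = 0`.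
[cite: Verbitsky1995Trianalytic, §2 (Proposition "S₀ is dense in S", proof)] -/
theorem adAlt_I_J_K_eq_zero_of_two (h : IsLinearHyperkaehler g₀ J) {β : E [⋀^Fin k]→L[ℝ] W}
    {x y : Fin 3 → ℝ} (hxy : x ⨯₃ y ≠ 0)
    (hβx : adAlt (x 0 • opI E + x 1 • J + x 2 • opK J) β = 0)
    (hβy : adAlt (y 0 • opI E + y 1 • J + y 2 • opK J) β = 0) :
    adAlt (opI E) β = 0 ∧ adAlt J β = 0 ∧ adAlt (opK J) β = 0 := by
  refine ⟨?_, ?_, ?_⟩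
  · simpa using h.adAlt_twistorOp_eq_zero_of_two hxy hβx hβy ![1, 0, 0]
  · simpa using h.adAlt_twistorOp_eq_zero_of_two hxy hβx hβy ![0, 1, 0]
  · simpa using h.adAlt_twistorOp_eq_zero_of_two hxy hβx hβy ![0, 0, 1]

/-- **Prop. 1.2, Lie-algebra form, all degrees**: `β` is annihilated by `ad L` for EVERY induced complex structure
`L = aI + bJ + cK`, `a² + b² + c² = 1` ("of Hodge type `(p,p)` with respect to all induced complex structures",
by FILE 1 read on `(E, L)`) iff `ad I β = 0` and `ad J β = 0` (`𝔤_M = 𝔰𝔲(2)` acts trivially: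
"`G_M`-invariant"). [cite: Verbitsky1996Hyperholomorphic, §1 Prop. 1.2] -/
theorem forall_unit_adAlt_twistorOp_eq_zero_iff (h : IsLinearHyperkaehler g₀ J) {β : E [⋀^Fin k]→L[ℝ] W} :
    (∀ x : Fin 3 → ℝ, x 0 ^ 2 + x 1 ^ 2 + x 2 ^ 2 = 1 → adAlt (x 0 • opI E + x 1 • J + x 2 • opK J) β = 0) ↔
      adAlt (opI E) β = 0 ∧ adAlt J β = 0 := by
  constructor
  · intro hall
    refine ⟨?_, ?_⟩
    · simpa using hall ![1, 0, 0] (by simp)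
    · simpa using hall ![0, 1, 0] (by simp)
  · rintro ⟨hI, hJ⟩ x _
    exact h.adAlt_twistorOp_eq_zero hI hJ x

/-- **Prop. 1.2 at the given complex structure, even degree**: an `𝔰𝔲(2)`-trivial `ℂ`-valued `2p`-covector is of
type `(p,p)` for `I` (FILE 1 `adAlt_eq_zero_iff_isOfTypeAt`). [cite: Verbitsky1996Hyperholomorphic, §1 Prop. 1.2] -/
theorem isOfTypeAt_of_adAlt_opI_eq_zero {p : ℕ} (hk : p + p = k) {β : E [⋀^Fin k]→L[ℝ] ℂ}
    (hI : adAlt (opI E) β = 0) : IsOfTypeAt p p β :=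
  (adAlt_eq_zero_iff_isOfTypeAt (T := opI E) (fun w ↦ opI_apply w) hk).1 hI

/-- **No odd-degree invariants**: an `𝔰𝔲(2)`-trivial (indeed an `ad I`-trivial) `ℂ`-valued covector of odd degree
vanishes. [cite: Verbitsky1996Hyperholomorphic, §1 Prop. 1.2 (proof)] -/
theorem eq_zero_of_adAlt_opI_eq_zero_of_odd (hk : Odd k) {β : E [⋀^Fin k]→L[ℝ] ℂ} (hI : adAlt (opI E) β = 0) :
    β = 0 :=
  (adAlt_eq_zero_iff_eq_zero_of_odd (T := opI E) (fun w ↦ opI_apply w) hk).1 hI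

/-! ## §3 At most two (opposite) induced complex structures annihilate a non-invariant covector -/

/-- Unit vectors with vanishing cross product are equal or opposite. [folklore] -/
private theorem eq_or_eq_neg_of_cross_eq_zero' {x y : Fin 3 → ℝ} (hx : x ⬝ᵥ x = 1) (hy : y ⬝ᵥ y = 1)
    (h0 : x ⨯₃ y = 0) : x = y ∨ x = -y := by
  have h1 : x ⬝ᵥ y * (x ⬝ᵥ y) = 1 := by
    have e := cross_dot_cross x y x y
    rw [h0, dotProduct_zero, hx, hy, dotProduct_comm y x] at e
    linarith
  rcases mul_self_eq_one_iff.1 h1 with h | h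
  · left
    have e : (x - y) ⬝ᵥ (x - y) = 0 := by
      rw [sub_dotProduct, dotProduct_sub, dotProduct_sub, hx, hy, dotProduct_comm y x, h]; ring
    exact sub_eq_zero.1 (dotProduct_self_eq_zero.1 e)
  · right
    have e : (x + y) ⬝ᵥ (x + y) = 0 := by
      rw [add_dotProduct, dotProduct_add, dotProduct_add, hx, hy, dotProduct_comm y x, h]; ring
    exact eq_neg_of_add_eq_zero_left (dotProduct_self_eq_zero.1 e)

/-- **A non-invariant covector is annihilated by `ad R` for at most two, opposite, induced complex structures
`R`** ("if `α` is not `G_M`-invariant there are no more than two `R ∈ S` such that `ad R(α) = 0`. Of course,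
these two elements of `S` are opposite to each other"), all degrees `2p` of the source (indeed any degree, any
values). [cite: Verbitsky1995Trianalytic, §2 (Proposition "S₀ is dense in S", proof)] -/
theorem eq_or_eq_neg_of_adAlt_twistorOp_eq_zero (h : IsLinearHyperkaehler g₀ J) {β : E [⋀^Fin k]→L[ℝ] W}
    (hβ : ¬ (adAlt (opI E) β = 0 ∧ adAlt J β = 0)) {x y : Fin 3 → ℝ} (hx : x 0 ^ 2 + x 1 ^ 2 + x 2 ^ 2 = 1)
    (hy : y 0 ^ 2 + y 1 ^ 2 + y 2 ^ 2 = 1) (hβx : adAlt (x 0 • opI E + x 1 • J + x 2 • opK J) β = 0)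
    (hβy : adAlt (y 0 • opI E + y 1 • J + y 2 • opK J) β = 0) : x = y ∨ x = -y := by
  by_contra hne
  obtain ⟨h1, h2⟩ := not_or.1 hne
  have hx' : x ⬝ᵥ x = 1 := by rw [Matrix.vec3_dotProduct, ← hx]; ring
  have hy' : y ⬝ᵥ y = 1 := by rw [Matrix.vec3_dotProduct, ← hy]; ring
  have hxy : x ⨯₃ y ≠ 0 := fun h0 ↦ (eq_or_eq_neg_of_cross_eq_zero' hx' hy' h0).elim h1 h2
  have h3 := h.adAlt_I_J_K_eq_zero_of_two hxy hβx hβy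
  exact hβ ⟨h3.1, h3.2.1⟩

/-- The set `S_β ⊂ S²` of unit parameters whose twistor operator annihilates a NON-invariant covector `β` is
finite (at most two antipodal points): "`S_α` is a finite set".
[cite: Verbitsky1995Trianalytic, §2 (Proposition "S₀ is dense in S", proof)] -/
theorem finite_setOf_adAlt_twistorOp_eq_zero (h : IsLinearHyperkaehler g₀ J) {β : E [⋀^Fin k]→L[ℝ] W}
    (hβ : ¬ (adAlt (opI E) β = 0 ∧ adAlt J β = 0)) :
    {x : Fin 3 → ℝ | x 0 ^ 2 + x 1 ^ 2 + x 2 ^ 2 = 1 ∧ adAlt (x 0 • opI E + x 1 • J + x 2 • opK J) β = 0}.Finite := by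
  by_cases hS : {x : Fin 3 → ℝ | x 0 ^ 2 + x 1 ^ 2 + x 2 ^ 2 = 1 ∧
      adAlt (x 0 • opI E + x 1 • J + x 2 • opK J) β = 0}.Nonempty
  · obtain ⟨x₀, hx₀, hβx₀⟩ := hS
    refine ((Set.finite_singleton (-x₀)).insert x₀).subset fun x hx ↦ ?_
    rcases h.eq_or_eq_neg_of_adAlt_twistorOp_eq_zero hβ hx.1 hx₀ hx.2 hβx₀ with e | e
    · exact Or.inl e
    · exact Or.inr e
  · rw [Set.not_nonempty_iff_eq_empty.1 hS]
    exact Set.finite_empty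

/-! ## §4 Genericity: the exceptional parameters of a countable family are countable, with dense complement -/

/-- **Generic induced complex structures are of general type**, all degrees ("Let `A` be the set of all
`α ∈ H^{2p}(M, ℤ)` such that `α` is not `G_M`-invariant. The set `A` is countable. … `S₀` is a complement of a
countable set to a 2-sphere"), pointwise for an arbitrary COUNTABLE family `A` of `k`-covectors (e.g. the
rational constant `k`-forms of a hyperkähler complex torus): the set of unit parameters `x` for which SOME
non-invariant member of `A` is annihilated by `ad λ_x` is countable.
[cite: Verbitsky1995Trianalytic, §2 (Proposition "S₀ is dense in S")] -/
theorem countable_setOf_exists_adAlt_twistorOp_eq_zero (h : IsLinearHyperkaehler g₀ J)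
    {A : Set (E [⋀^Fin k]→L[ℝ] W)} (hA : A.Countable) :
    {x : Fin 3 → ℝ | x 0 ^ 2 + x 1 ^ 2 + x 2 ^ 2 = 1 ∧ ∃ β ∈ A, ¬ (adAlt (opI E) β = 0 ∧ adAlt J β = 0) ∧
      adAlt (x 0 • opI E + x 1 • J + x 2 • opK J) β = 0}.Countable := by
  have hsub : {x : Fin 3 → ℝ | x 0 ^ 2 + x 1 ^ 2 + x 2 ^ 2 = 1 ∧ ∃ β ∈ A,
      ¬ (adAlt (opI E) β = 0 ∧ adAlt J β = 0) ∧ adAlt (x 0 • opI E + x 1 • J + x 2 • opK J) β = 0} ⊆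
      ⋃ β ∈ A, {x : Fin 3 → ℝ | ¬ (adAlt (opI E) β = 0 ∧ adAlt J β = 0) ∧
        (x 0 ^ 2 + x 1 ^ 2 + x 2 ^ 2 = 1 ∧ adAlt (x 0 • opI E + x 1 • J + x 2 • opK J) β = 0)} := by
    rintro x ⟨hx, β, hβA, hβ, hβx⟩
    exact Set.mem_biUnion hβA ⟨hβ, hx, hβx⟩
  refine (Set.Countable.biUnion hA fun β _ ↦ ?_).mono hsub
  by_cases hβ : adAlt (opI E) β = 0 ∧ adAlt J β = 0
  · exact Set.countable_empty.mono fun x hx ↦ (hx.1 hβ).elim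
  · exact ((h.finite_setOf_adAlt_twistorOp_eq_zero hβ).subset fun x hx ↦ hx.2).countable

/-- A unit vector of `ℝ³` orthogonal to a given vector. [folklore] -/
private theorem exists_unit_orthogonal'' (a b c : ℝ) :
    ∃ p q r : ℝ, p ^ 2 + q ^ 2 + r ^ 2 = 1 ∧ a * p + b * q + c * r = 0 := by
  by_cases hbc : b ^ 2 + c ^ 2 = 0
  · have hb : b = 0 := (pow_eq_zero_iff two_ne_zero).1 (by nlinarith [sq_nonneg b, sq_nonneg c])
    have hc : c = 0 := (pow_eq_zero_iff two_ne_zero).1 (by nlinarith [sq_nonneg b, sq_nonneg c])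
    exact ⟨0, 1, 0, by norm_num, by rw [hb, hc]; ring⟩
  · have hpos : 0 < b ^ 2 + c ^ 2 := lt_of_le_of_ne (by positivity) (Ne.symm hbc)
    set t := Real.sqrt (b ^ 2 + c ^ 2) with ht
    have ht2 : t ^ 2 = b ^ 2 + c ^ 2 := Real.sq_sqrt hpos.le
    have ht0 : t ≠ 0 := (Real.sqrt_pos.2 hpos).ne'
    have H1 : t⁻¹ ^ 2 * (b ^ 2 + c ^ 2) = 1 := by
      rw [← ht2, inv_pow, inv_mul_cancel₀ (pow_ne_zero 2 ht0)]
    refine ⟨0, c / t, -b / t, ?_, ?_⟩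
    · linear_combination H1
    · ring

/-- **A countable subset of the `2`-sphere has dense complement in the sphere** ("`S₀` is a complement of a
countable set to a 2-sphere `S`, and therefore dense in `S`"): every unit `x` is within any `ε > 0` of a unit
`x' ∉ B` (the great circle through `x` is injective on `[−π/2, π/2]` and meets `B` in countably many
parameters, whose complement is dense in `ℝ`). [cite: Verbitsky1995Trianalytic, §2 (Proposition "S₀ is dense in S", proof)] -/
theorem exists_unit_near_not_mem_of_countable {B : Set (Fin 3 → ℝ)} (hB : B.Countable) {x : Fin 3 → ℝ}
    (hx : x 0 ^ 2 + x 1 ^ 2 + x 2 ^ 2 = 1) {ε : ℝ} (hε : 0 < ε) :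
    ∃ x' : Fin 3 → ℝ, x' 0 ^ 2 + x' 1 ^ 2 + x' 2 ^ 2 = 1 ∧ dist x' x < ε ∧ x' ∉ B := by
  -- the great circle `θ ↦ cos θ · x + sin θ · u` through `x`, `u ⟂ x` a unit vector
  obtain ⟨p, q, r, hu, horth⟩ := exists_unit_orthogonal'' (x 0) (x 1) (x 2)
  set u : Fin 3 → ℝ := ![p, q, r] with hu_def
  set γ : ℝ → (Fin 3 → ℝ) := fun θ ↦ Real.cos θ • x + Real.sin θ • u with hγ_def
  have hγ1 : ∀ θ, (γ θ) 0 ^ 2 + (γ θ) 1 ^ 2 + (γ θ) 2 ^ 2 = 1 := fun θ ↦ by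
    simp only [hγ_def, hu_def, Pi.add_apply, Pi.smul_apply, smul_eq_mul, Matrix.cons_val_zero,
      Matrix.cons_val_one, Matrix.cons_val_two, Matrix.head_cons, Matrix.tail_cons]
    linear_combination (Real.cos θ) ^ 2 * hx + (Real.sin θ) ^ 2 * hu +
      2 * Real.cos θ * Real.sin θ * horth + Real.cos_sq_add_sin_sq θ
  -- it is injective on `[-π/2, π/2]` (`sin θ = ⟨u, γ θ⟩`)
  have hinj : Set.InjOn γ (Set.Icc (-(Real.pi / 2)) (Real.pi / 2)) := by
    intro θ₁ h₁ θ₂ h₂ heq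
    have e := congrArg (fun w : Fin 3 → ℝ ↦ p * w 0 + q * w 1 + r * w 2) heq
    simp only [hγ_def, hu_def, Pi.add_apply, Pi.smul_apply, smul_eq_mul, Matrix.cons_val_zero,
      Matrix.cons_val_one, Matrix.cons_val_two, Matrix.head_cons, Matrix.tail_cons] at e
    have hs : Real.sin θ₁ = Real.sin θ₂ := by
      linear_combination e - (Real.sin θ₁ - Real.sin θ₂) * hu - (Real.cos θ₁ - Real.cos θ₂) * horth
    exact Real.injOn_sin h₁ h₂ hs
  have hT : (Set.Icc (-(Real.pi / 2)) (Real.pi / 2) ∩ γ ⁻¹' B).Countable :=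
    Set.MapsTo.countable_of_injOn (f := γ) (t := B) (fun θ hθ ↦ hθ.2) (hinj.mono Set.inter_subset_left) hB
  have hdense : Dense (Set.Icc (-(Real.pi / 2)) (Real.pi / 2) ∩ γ ⁻¹' B)ᶜ := hT.dense_compl ℝ
  have hcont : Continuous γ :=
    (Real.continuous_cos.smul continuous_const).add (Real.continuous_sin.smul continuous_const)
  have hγ0 : γ 0 = x := by simp [hγ_def]
  obtain ⟨δ, hδ, hδε⟩ := Metric.continuous_iff.1 hcont 0 ε hε
  have hm : 0 < min δ 1 := lt_min hδ one_pos
  obtain ⟨θ, hθU, hθT⟩ := hdense.inter_open_nonempty (Set.Ioo (-min δ 1) (min δ 1)) isOpen_Ioo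
    ⟨0, by rw [Set.mem_Ioo]; exact ⟨by linarith, hm⟩⟩
  have hθabs : |θ| < min δ 1 := abs_lt.2 ⟨hθU.1, hθU.2⟩
  refine ⟨γ θ, hγ1 θ, ?_, fun hmem ↦ ?_⟩
  · rw [← hγ0]
    exact hδε θ (by rw [Real.dist_eq, sub_zero]; exact hθabs.trans_le (min_le_left _ _))
  · apply hθT
    have h1 : |θ| < 1 := hθabs.trans_le (min_le_right _ _)
    have hπ : (1 : ℝ) ≤ Real.pi / 2 := by linarith [Real.pi_gt_three]
    exact ⟨⟨by linarith [(abs_lt.1 h1).1], by linarith [(abs_lt.1 h1).2]⟩, hmem⟩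

/-- **Generic induced complex structures are dense**, all degrees: for a countable family `A` of `k`-covectors
every unit parameter `x` is within any `ε > 0` of a unit `x'` such that every member of `A` annihilated by
`ad λ_{x'}` is `𝔰𝔲(2)`-trivial. [cite: Verbitsky1995Trianalytic, §2 (Proposition "S₀ is dense in S")] -/
theorem exists_near_forall_adAlt_twistorOp_eq_zero_imp (h : IsLinearHyperkaehler g₀ J)
    {A : Set (E [⋀^Fin k]→L[ℝ] W)} (hA : A.Countable) {x : Fin 3 → ℝ} (hx : x 0 ^ 2 + x 1 ^ 2 + x 2 ^ 2 = 1)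
    {ε : ℝ} (hε : 0 < ε) :
    ∃ x' : Fin 3 → ℝ, x' 0 ^ 2 + x' 1 ^ 2 + x' 2 ^ 2 = 1 ∧ dist x' x < ε ∧
      ∀ β ∈ A, adAlt (x' 0 • opI E + x' 1 • J + x' 2 • opK J) β = 0 → adAlt (opI E) β = 0 ∧ adAlt J β = 0 := by
  obtain ⟨x', hx', hd, hnot⟩ := exists_unit_near_not_mem_of_countable
    (h.countable_setOf_exists_adAlt_twistorOp_eq_zero hA) hx hε
  refine ⟨x', hx', hd, fun β hβA hβx' ↦ ?_⟩
  by_contra hSU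
  exact hnot ⟨hx', β, hβA, hSU, hβx'⟩

/-! ## §5 Degree two: `ad T β = 0` is `T`-invariance; bridge to the invariance formulation -/

/-- **Degree `2`: `ad T β = 0 ⟺ β(T·, T·) = β`** for an operator with `T² = −1` (the degree-`2` dictionary
between the Lie-algebra condition and the invariance used in `InvariantTwoFormsTwistorPrimitive.lean` /
`GenericInducedComplexStructure.lean`: "`α` is of type `(p,p)` with respect to `R` iff `ad R(α) = 0`", `p = 1`).
[cite: Verbitsky1995Trianalytic, §2 (Proposition "S₀ is dense in S", proof)] -/
theorem adAlt_eq_zero_iff_apply₂_invariant {T : E →L[ℝ] E} (hT : ∀ v, T (T v) = -v)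
    {β : E [⋀^Fin 2]→L[ℝ] W} : adAlt T β = 0 ↔ ∀ v w : E, β ![T v, T w] = β ![v, w] := by
  constructor
  · intro h v w
    refine apply₂_invariant_of_skew (T := T) hT (fun v w ↦ ?_) v w
    have e := congrArg (fun γ : E [⋀^Fin 2]→L[ℝ] W ↦ γ ![v, w]) h
    simp only [adAlt_apply_two, ContinuousAlternatingMap.coe_zero, Pi.zero_apply] at e
    exact eq_neg_of_add_eq_zero_left e
  · intro hinv
    ext v
    have hv : v = ![v 0, v 1] := by
      ext i
      fin_cases i <;> rfl
    rw [hv, adAlt_apply_two, apply₂_skew_of_invariant (T := T) hT hinv, ContinuousAlternatingMap.coe_zero,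
      Pi.zero_apply, neg_add_cancel]

/-- **Degree `2` bridge**: `ad I β = 0 ∧ ad J β = 0` iff `β(I·, I·) = β = β(J·, J·)` — the `SU(2)`-invariance of
`2`-covectors of `InvariantTwoFormsTwistorPrimitive.lean` / `GenericInducedComplexStructure.lean` (and, at a point
of a hyperkähler manifold, the tree's `IsSU2InvariantAt` by `isSU2InvariantAt_iff`), so that the all-degree
statements above restrict to the degree-`2` ones already in the tree. [cite: Verbitsky1996Hyperholomorphic, §1 Prop. 1.2] -/
theorem adAlt_opI_J_eq_zero_iff_apply₂_invariant (h : IsLinearHyperkaehler g₀ J) {β : E [⋀^Fin 2]→L[ℝ] W} :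
    (adAlt (opI E) β = 0 ∧ adAlt J β = 0) ↔
      ((∀ v w : E, β ![I • v, I • w] = β ![v, w]) ∧ ∀ v w : E, β ![J v, J w] = β ![v, w]) := by
  have hI : ∀ v : E, opI E (opI E v) = -v := fun v ↦ by
    rw [opI_apply, opI_apply, smul_smul, I_mul_I, neg_one_smul]
  rw [adAlt_eq_zero_iff_apply₂_invariant hI, adAlt_eq_zero_iff_apply₂_invariant h.J_J]
  simp only [opI_apply]

end IsLinearHyperkaehler

/-! ## §6 At a point of a hyperkähler manifold -/

section Manifold

open Bundle Literature.Geometry.Kaehler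

variable {M : Type*} [TopologicalSpace M] [ChartedSpace E M]
  {g : RiemannianMetric (fun x : M ↦ TangentSpace 𝓘(ℝ, E) x)}
  {J' K' : ∀ x : M, TangentSpace 𝓘(ℝ, E) x →L[ℝ] TangentSpace 𝓘(ℝ, E) x}

/-- For a hyperkähler triple `(g, I, J, K)` of the tree, `K = IJ` at every point, i.e. `K_x = opK J_x`.
[cite: Huybrechts2016K3, Ch. 7 §3.2 Thm. 3.6] -/
theorem _root_.Literature.Geometry.Hyperkaehler.IsHyperkaehlerTriple.K_eq_opK (h : IsHyperkaehlerTriple g J' K')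
    (x : M) : (show E →L[ℝ] E from K' x) = opK (show E →L[ℝ] E from J' x) := by
  ext v
  exact (h.I_J x v).symm

/-- The induced complex structure `λ = aI + bJ + cK` of the tree (`inducedJ`) is the twistor operator
`a • opI + b • J_x + c • opK J_x` of the linear carrier at `x`. [cite: Huybrechts2016K3, Ch. 7 §3.2 (λ = aI + bJ + cK)] -/
theorem _root_.Literature.Geometry.Hyperkaehler.IsHyperkaehlerTriple.inducedJ_eq_twistorOp
    (h : IsHyperkaehlerTriple g J' K') (a b c : ℝ) (x : M) :
    (show E →L[ℝ] E from inducedJ J' K' a b c x) =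
      a • opI E + b • (show E →L[ℝ] E from J' x) + c • opK (show E →L[ℝ] E from J' x) := by
  rw [← h.K_eq_opK x]
  rfl

/-- **Prop. 1.2, Lie-algebra form, at a point of a hyperkähler manifold, all degrees**: a `k`-covector on
`T_x M` is annihilated by `ad L` for every induced complex structure `L = aI + bJ + cK` (the tree's
`inducedJ`, `(a,b,c) ∈ S²`) iff `ad I β = 0` and `ad J β = 0`. [cite: Verbitsky1996Hyperholomorphic, §1 Prop. 1.2] -/
theorem _root_.Literature.Geometry.Hyperkaehler.IsHyperkaehlerTriple.forall_adAlt_inducedJ_eq_zero_iff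
    (h : IsHyperkaehlerTriple g J' K') (x : M) {β : E [⋀^Fin k]→L[ℝ] W} :
    (∀ a b c : ℝ, a ^ 2 + b ^ 2 + c ^ 2 = 1 → adAlt (show E →L[ℝ] E from inducedJ J' K' a b c x) β = 0) ↔
      adAlt (opI E) β = 0 ∧ adAlt (show E →L[ℝ] E from J' x) β = 0 := by
  rw [← (h.isLinearHyperkaehler x).forall_unit_adAlt_twistorOp_eq_zero_iff]
  constructor
  · intro hall z hz
    have e := hall (z 0) (z 1) (z 2) hz
    rwa [h.inducedJ_eq_twistorOp] at e
  · intro hall a b c habc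
    rw [h.inducedJ_eq_twistorOp]
    simpa using hall ![a, b, c] (by simpa using habc)

/-- **Degree `2`: the tree's `IsSU2InvariantAt` is `ad I β = 0 ∧ ad J β = 0`** (so the hyperholomorphic
condition of `Hyperholomorphic.lean` — `SU(2)`-invariant curvature — is the vanishing of `ad I` and `ad J` on
the curvature entries). [cite: Verbitsky1996Hyperholomorphic, §1 Prop. 1.2 and Def. 2.1] -/
theorem _root_.Literature.Geometry.Hyperkaehler.IsHyperkaehlerTriple.isSU2InvariantAt_iff_adAlt
    (h : IsHyperkaehlerTriple g J' K') (x : M) (β : E [⋀^Fin 2]→L[ℝ] W) :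
    IsSU2InvariantAt J' K' x β ↔ adAlt (opI E) β = 0 ∧ adAlt (show E →L[ℝ] E from J' x) β = 0 := by
  rw [h.isSU2InvariantAt_iff x β, (h.isLinearHyperkaehler x).adAlt_opI_J_eq_zero_iff_apply₂_invariant]
  rfl

end Manifold

end Literature.Geometry.Hyperkaehler

end
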